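import Mathlib
import Summits.MatrixMultiplication.MatrixMultiplication.Theorems.SnSubsetDichotomyHyperoctahedralThresholdCleanPairDefs

/-!
# Clean-pair atom — inheritance of the level invariant and corner exclusion

Helper for crux `SnSubsetDichotomy.HyperoctahedralThreshold` (stmt-MatrixMultiplication-10883), line
`Lines/stub_plan_poorRigidCore.md`, proof plan `work/ATOM_PROOF.md` §3–§4 of the stub-plan prover seat.

* `pos_injective_slots`, `no_self_defect`: a separated `F`-avoiding reduced strand visits pairwise distinct vertices in its
  `2(d+1)` slots (given `F ⊇ F_cyc(2r)`), hence has no self-defect.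
* `inv_drop`, `inv_reverse` (+ `card_image_drop`, `card_image_reverse`): the level invariant `Inv` survives the PREFIX HOP
  (restrict to a full-prefix class, re-root at the common rung) and TIME REVERSAL; total dirtiness is inherited because no
  defect can involve a rung of the common-prefix zone.
* `closed_reduced_of_ne`, `toucher_time_gt`, `toucher_time_lt`: CORNER EXCLUSION — a defect of `β₁` against `β'` at the
  common point `pos β' σ' t` has `r < t < d - r`.
-/

-- the tree's namespace `Summit.MatrixMultiplication.MatrixMultiplication.…` repeats a component by design
set_option linter.dupNamespace false

namespace Summit.MatrixMultiplication.MatrixMultiplication.Theorems.HyperoctahedralThreshold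

namespace CleanPair

open TwinSupplyCS

variable {n : ℕ}

/-! ### No self-defects, and inheritance of the level invariant -/

section Inherit

variable {μ : Fin 3 → Equiv.Perm (Fin n)} {F : Finset (Fin n)} {r : ℕ}

/-- Two slots of one separated `F`-avoiding reduced strand never sit at the same vertex. -/
theorem pos_injective_slots (hF : NoShortCycleOutside μ F r) {p : Bool → Fin n} {β : List (Fin 3)}
    (hc : List.IsChain (· ≠ ·) β) (hA : Avoids μ F p β) (hS : Separated μ r p β)
    {σ σ' : Bool} {s t : ℕ} (hs : s ≤ β.length) (ht : t ≤ β.length)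
    (he : pos μ p β σ s = pos μ p β σ' t) : σ = σ' ∧ s = t := by
  -- separatedness leaves only: same side, |s - t| ≤ r
  have hnear : Near μ r (pos μ p β σ s) (pos μ p β σ' t) := by rw [he]; exact Near.rfl
  have key := hS σ σ' s t hs ht
  by_cases hσ : σ = σ'
  · subst hσ
    refine ⟨rfl, ?_⟩
    by_contra hst
    -- WLOG s < t; the word β_(s,t] is a nonempty reduced closed walk of length ≤ r at the common position
    rcases Nat.lt_or_gt_of_ne hst with hlt | hlt
    · have hle : t ≤ s + r := by
        by_contra h
        exact key (Or.inr (Or.inl (by omega))) hnear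
      refine hF _ (hA σ s hs) ((β.take t).drop s) ?_ ((hc.take t).drop s) ?_ ?_
      · intro h
        have := congrArg List.length h
        simp at this; omega
      · simp; omega
      · have e : pos μ p β σ t = act μ (pos μ p β σ s) ((β.take t).drop s) := by
          simp only [pos]
          rw [← act_append]
          congr 1
          conv_lhs => rw [← List.take_append_drop s (β.take t)]
          rw [List.take_take, Nat.min_eq_left hlt.le]
        rw [← e, he]
    · have hle : s ≤ t + r := by
        by_contra h
        exact key (Or.inr (Or.inr (by omega))) hnear
      refine hF _ (hA σ t ht) ((β.take s).drop t) ?_ ((hc.take s).drop t) ?_ ?_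
      · intro h
        have := congrArg List.length h
        simp at this; omega
      · simp; omega
      · have e : pos μ p β σ s = act μ (pos μ p β σ t) ((β.take s).drop t) := by
          simp only [pos]
          rw [← act_append]
          congr 1
          conv_lhs => rw [← List.take_append_drop t (β.take s)]
          rw [List.take_take, Nat.min_eq_left hlt.le]
        rw [← e, he]
  · exact absurd hnear (key (Or.inl hσ))

/-- A separated `F`-avoiding reduced strand has no self-defect: its own rungs are pairwise disjoint (or equal). -/
theorem no_self_defect (hF : NoShortCycleOutside μ F r) {p : Bool → Fin n} {β : List (Fin 3)}
    (hc : List.IsChain (· ≠ ·) β) (hA : Avoids μ F p β) (hS : Separated μ r p β)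
    {s t : ℕ} (hs : s ≤ β.length) (ht : t ≤ β.length) : ¬ Defect μ p β β s t := by
  rintro ⟨σ, σ', h1, h2⟩
  obtain ⟨rfl, rfl⟩ := pos_injective_slots hF hc hA hS hs ht h1
  exact h2 rfl

/-- **Prefix hop preserves the invariant.**  Restricting a level to the members with a given prefix `P` of length
`t' ≤ d`, re-rooted at the common rung of time `t'`, is again a level; total dirtiness is inherited because with
self-defect-free strands no defect can involve a rung of the common-prefix zone. -/
theorem inv_drop (hμ : ∀ c, μ c * μ c = 1) (hF : NoShortCycleOutside μ F r) {p : Bool → Fin n} {d : ℕ}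
    {S : Finset (List (Fin 3))} (hI : Inv μ F r p d S) (P : List (Fin 3)) {t' : ℕ}
    (ht' : t' ≤ d) (β₀ : List (Fin 3)) (hβ₀P : β₀.take t' = P) :
    Inv μ F r (fun τ => pos μ p β₀ τ t') (d - t')
      ((S.filter fun β => β.take t' = P).image fun β => β.drop t') := by
  obtain ⟨hroot, hmem, hcell, hdirty⟩ := hI
  -- a member with prefix `P` has the same positions as `β₀` up to time `t'`
  have hcommon : ∀ β ∈ S, β.take t' = P → ∀ σ, ∀ s ≤ t', pos μ p β σ s = pos μ p β₀ σ s := by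
    intro β hβ hβP σ s hs
    simp only [pos]
    have h1 : β.take s = (β.take t').take s := by rw [List.take_take, Nat.min_eq_left hs]
    have h2 : β₀.take s = (β₀.take t').take s := by rw [List.take_take, Nat.min_eq_left hs]
    rw [h1, h2, hβP, hβ₀P]
  -- positions of the suffix strands
  have hpos : ∀ β ∈ S, β.take t' = P → ∀ τ u,
      pos μ (fun τ => pos μ p β₀ τ t') (β.drop t') τ u = pos μ p β τ (t' + u) := by
    intro β hβ hβP τ u
    rw [← pos_drop μ p β τ t' u]
    congr 1
    funext τ'
    exact (hcommon β hβ hβP τ' t' le_rfl).symm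
  refine ⟨?_, ?_, ?_, ?_⟩
  · -- root points distinct
    intro h
    simp only [pos] at h
    exact hroot (by
      have := congrArg (fun y => act μ y (β₀.take t').reverse) h
      simpa [act_act_reverse μ (involutive_of_mul_self μ hμ)] using this)
  · -- members
    intro γ hγ
    rw [Finset.mem_image] at hγ
    obtain ⟨β, hβ, rfl⟩ := hγ
    rw [Finset.mem_filter] at hβ
    obtain ⟨hβS, hβP⟩ := hβ
    obtain ⟨hlen, hc, hA, hSep⟩ := hmem β hβS
    refine ⟨by simp [hlen], hc.drop t', ?_, ?_⟩
    · intro σ t ht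
      rw [hpos β hβS hβP]
      exact hA σ (t' + t) (by simp at ht; omega)
    · intro σ σ' t t'' ht htt' hexc hnear
      rw [hpos β hβS hβP, hpos β hβS hβP] at hnear
      refine hSep σ σ' (t' + t) (t' + t'') (by simp at ht; omega) (by simp at htt'; omega) ?_ hnear
      rcases hexc with h | h | h
      · exact Or.inl h
      · exact Or.inr (Or.inl (by omega))
      · exact Or.inr (Or.inr (by omega))
  · -- single cell
    intro γ hγ γ' hγ' σ
    rw [Finset.mem_image] at hγ hγ'
    obtain ⟨β, hβ, rfl⟩ := hγ
    obtain ⟨β', hβ', rfl⟩ := hγ'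
    rw [Finset.mem_filter] at hβ hβ'
    rw [hpos β hβ.1 hβ.2, hpos β' hβ'.1 hβ'.2, Nat.add_sub_cancel' ht']
    exact hcell β hβ.1 β' hβ'.1 σ
  · -- totally dirty, inherited
    intro γ hγ γ' hγ' hne
    rw [Finset.mem_image] at hγ hγ'
    obtain ⟨β, hβ, rfl⟩ := hγ
    obtain ⟨β', hβ', rfl⟩ := hγ'
    rw [Finset.mem_filter] at hβ hβ'
    have hne' : β ≠ β' := fun h => hne (by rw [h])
    obtain ⟨s, hs, t, ht, σ, σ', h1, h2⟩ := hdirty β hβ.1 β' hβ'.1 hne'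
    obtain ⟨hlen, hc, hA, hSep⟩ := hmem β hβ.1
    obtain ⟨hlen', hc', hA', hSep'⟩ := hmem β' hβ'.1
    -- the defect avoids the common prefix zone on both strands
    have hs' : t' < s := by
      by_contra hle
      push Not at hle
      have e : ∀ τ, pos μ p β τ s = pos μ p β' τ s := fun τ =>
        (hcommon β hβ.1 hβ.2 τ s hle).trans (hcommon β' hβ'.1 hβ'.2 τ s hle).symm
      rw [e] at h1
      rw [e] at h2
      exact no_self_defect hF hc' hA' hSep' (by omega) (by omega) ⟨σ, σ', h1, h2⟩
    have ht'' : t' < t := by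
      by_contra hle
      push Not at hle
      have e : ∀ τ, pos μ p β' τ t = pos μ p β τ t := fun τ =>
        (hcommon β' hβ'.1 hβ'.2 τ t hle).trans (hcommon β hβ.1 hβ.2 τ t hle).symm
      rw [e] at h1
      rw [e] at h2
      exact no_self_defect hF hc hA hSep (by omega) (by omega) ⟨σ, σ', h1, h2⟩
    refine ⟨s - t', by omega, t - t', by omega, σ, σ', ?_, ?_⟩
    · rw [hpos β hβ.1 hβ.2, hpos β' hβ'.1 hβ'.2, Nat.add_sub_cancel' hs'.le, Nat.add_sub_cancel' ht''.le]
      exact h1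
    · rw [hpos β hβ.1 hβ.2, hpos β' hβ'.1 hβ'.2, Nat.add_sub_cancel' hs'.le, Nat.add_sub_cancel' ht''.le]
      exact h2

/-- The prefix hop does not merge members: `drop t'` is injective on a prefix class. -/
theorem card_image_drop {S : Finset (List (Fin 3))} (P : List (Fin 3)) (t' : ℕ) :
    ((S.filter fun β => β.take t' = P).image fun β => β.drop t').card = (S.filter fun β => β.take t' = P).card := by
  refine Finset.card_image_of_injOn ?_
  intro β hβ β' hβ' h
  rw [Finset.coe_filter] at hβ hβ'
  have e1 := List.take_append_drop t' β
  have e2 := List.take_append_drop t' β'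
  rw [← e1, ← e2, hβ.2, hβ'.2]
  exact congrArg _ h

/-- **Time reversal preserves the invariant.**  Reading every member backwards from the common cell gives a level of the
same depth whose cell is the old root. -/
theorem inv_reverse (hμ : ∀ c, μ c * μ c = 1) {p : Bool → Fin n} {d : ℕ} {S : Finset (List (Fin 3))}
    (hI : Inv μ F r p d S) (β₀ : List (Fin 3)) (hβ₀ : β₀ ∈ S) :
    Inv μ F r (fun τ => pos μ p β₀ τ d) d (S.image List.reverse) := by
  obtain ⟨hroot, hmem, hcell, hdirty⟩ := hI
  have hlen₀ : β₀.length = d := (hmem β₀ hβ₀).1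
  -- positions of reversed strands
  have hpos : ∀ β ∈ S, ∀ τ, ∀ u ≤ d, pos μ (fun τ => pos μ p β₀ τ d) β.reverse τ u = pos μ p β τ (d - u) := by
    intro β hβ τ u hu
    have hlen : β.length = d := (hmem β hβ).1
    have e : (fun τ => pos μ p β₀ τ d) = fun τ => pos μ p β τ β.length := by
      funext τ'; rw [hlen]; exact (hcell β hβ β₀ hβ₀ τ').symm
    rw [e, pos_reverse μ hμ p β τ u, hlen]
  refine ⟨?_, ?_, ?_, ?_⟩
  · -- root points distinct (old cell points)
    intro h
    simp only [pos] at h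
    rw [← hlen₀, List.take_length] at h
    exact hroot (by
      have := congrArg (fun y => act μ y β₀.reverse) h
      simpa [act_act_reverse μ (involutive_of_mul_self μ hμ)] using this)
  · -- members
    intro γ hγ
    rw [Finset.mem_image] at hγ
    obtain ⟨β, hβ, rfl⟩ := hγ
    obtain ⟨hlen, hc, hA, hSep⟩ := hmem β hβ
    refine ⟨by simp [hlen], List.isChain_reverse.mpr (hc.imp fun a b h => Ne.symm h), ?_, ?_⟩
    · intro σ t ht
      simp only [List.length_reverse, hlen] at ht
      rw [hpos β hβ σ t ht]
      exact hA σ (d - t) (by omega)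
    · intro σ σ' t t' ht ht' hexc hnear
      simp only [List.length_reverse, hlen] at ht ht'
      rw [hpos β hβ σ t ht, hpos β hβ σ' t' ht'] at hnear
      refine hSep σ σ' (d - t) (d - t') (by omega) (by omega) ?_ hnear
      rcases hexc with h | h | h
      · exact Or.inl h
      · exact Or.inr (Or.inr (by omega))
      · exact Or.inr (Or.inl (by omega))
  · -- single cell (the old root)
    intro γ hγ γ' hγ' σ
    rw [Finset.mem_image] at hγ hγ'
    obtain ⟨β, hβ, rfl⟩ := hγ
    obtain ⟨β', hβ', rfl⟩ := hγ'
    rw [hpos β hβ σ d le_rfl, hpos β' hβ' σ d le_rfl, Nat.sub_self, pos_zero, pos_zero]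
  · -- totally dirty
    intro γ hγ γ' hγ' hne
    rw [Finset.mem_image] at hγ hγ'
    obtain ⟨β, hβ, rfl⟩ := hγ
    obtain ⟨β', hβ', rfl⟩ := hγ'
    have hne' : β ≠ β' := fun h => hne (by rw [h])
    obtain ⟨s, hs, t, ht, σ, σ', h1, h2⟩ := hdirty β hβ β' hβ' hne'
    refine ⟨d - s, by omega, d - t, by omega, σ, σ', ?_, ?_⟩
    · rw [hpos β hβ σ (d - s) (by omega), hpos β' hβ' σ' (d - t) (by omega),
        Nat.sub_sub_self hs, Nat.sub_sub_self ht]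
      exact h1
    · rw [hpos β hβ (!σ) (d - s) (by omega), hpos β' hβ' (!σ') (d - t) (by omega),
        Nat.sub_sub_self hs, Nat.sub_sub_self ht]
      exact h2

/-- Reversal does not merge members. -/
theorem card_image_reverse (S : Finset (List (Fin 3))) : (S.image List.reverse).card = S.card :=
  Finset.card_image_of_injective _ List.reverse_injective

/-! ### Corner exclusion: a toucher's time is far from both ends -/

/-- **Corner exclusion.**  In a level, if the rung of `β₁` at time `s` and the rung of `β'` at time `t` share the point
`pos β₁ σ₁ s = pos β' σ' t` with a mismatch on the other side, then `t > r`: otherwise that point is `r`-near the root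
point `p σ'`, separatedness of `β₁` forces `σ₁ = σ'` and `s ≤ r`, and the two short legs from `p σ'` to the common
point — distinct, since equal legs would make the rungs equal — close a nonempty reduced walk of length `≤ 2r` at a
strand position, which `F ⊇ F_cyc(2r)` forbids. -/
theorem toucher_time_gt (hμ : ∀ c, μ c * μ c = 1) (hF : NoShortCycleOutside μ F r) {p : Bool → Fin n} {d : ℕ}
    {S : Finset (List (Fin 3))} (hI : Inv μ F r p d S) {β₁ β' : List (Fin 3)} (hβ₁ : β₁ ∈ S) (hβ' : β' ∈ S)
    {σ₁ σ' : Bool} {s t : ℕ} (hs : s ≤ d) (ht : t ≤ d)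
    (h1 : pos μ p β₁ σ₁ s = pos μ p β' σ' t) (h2 : pos μ p β₁ (!σ₁) s ≠ pos μ p β' (!σ') t) : r < t := by
  obtain ⟨_, hmem, _, _⟩ := hI
  obtain ⟨hlen₁, hc₁, hA₁, hSep₁⟩ := hmem β₁ hβ₁
  obtain ⟨hlen', hc', _, _⟩ := hmem β' hβ'
  by_contra htr
  push Not at htr
  -- the common point is `t`-near the root point on side σ'
  have hnear : Near μ r (pos μ p β₁ σ₁ s) (pos μ p β₁ σ' 0) := by
    rw [h1, pos_zero]
    refine (near_act μ (p σ') (β'.take t) ?_).symm hμ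
    simp; omega
  have key := hSep₁ σ₁ σ' s 0 (by omega) (by omega)
  have hσ : σ₁ = σ' := by
    by_contra hσ
    exact key (Or.inl hσ) hnear
  subst hσ
  have hsr : s ≤ r := by
    by_contra hsr
    exact key (Or.inr (Or.inr (by omega))) hnear
  -- the two legs from `p σ₁` to the common point
  have hlegs : act μ (p σ₁) (β₁.take s) = act μ (p σ₁) (β'.take t) := h1
  by_cases heq : β₁.take s = β'.take t
  · -- equal legs: then s = t and the rungs coincide on both sides
    have hst : s = t := by
      have := congrArg List.length heq
      simp at this; omega
    subst hst
    apply h2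
    simp only [pos]
    rw [heq]
  · obtain ⟨w, hw1, hw2, hw3, hw4⟩ :=
      closed_reduced_of_ne μ hμ (β₁.take s) (β'.take t) (p σ₁) heq (hc₁.take s) (hc'.take t) hlegs
    refine hF (pos μ p β₁ σ₁ s) (hA₁ σ₁ s (by omega)) w hw1 hw2 ?_ hw4
    have : (β₁.take s).length + (β'.take t).length ≤ 2 * r := by simp; omega
    omega

/-- Corner exclusion at the far end, by time reversal: the toucher's time is also `< d - r`. -/
theorem toucher_time_lt (hμ : ∀ c, μ c * μ c = 1) (hF : NoShortCycleOutside μ F r) {p : Bool → Fin n} {d : ℕ}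
    {S : Finset (List (Fin 3))} (hI : Inv μ F r p d S) {β₁ β' : List (Fin 3)} (hβ₁ : β₁ ∈ S) (hβ' : β' ∈ S)
    {σ₁ σ' : Bool} {s t : ℕ} (hs : s ≤ d) (ht : t ≤ d)
    (h1 : pos μ p β₁ σ₁ s = pos μ p β' σ' t) (h2 : pos μ p β₁ (!σ₁) s ≠ pos μ p β' (!σ') t) : t + r < d := by
  have hI' := inv_reverse hμ hI β₁ hβ₁
  obtain ⟨_, hmem, hcell, _⟩ := hI
  have hlen₁ : β₁.length = d := (hmem β₁ hβ₁).1
  have hlen' : β'.length = d := (hmem β' hβ').1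
  -- positions of the reversed strands
  have e₁ : ∀ τ u, u ≤ d → pos μ (fun τ => pos μ p β₁ τ d) β₁.reverse τ u = pos μ p β₁ τ (d - u) := by
    intro τ u _
    rw [← hlen₁]; exact pos_reverse μ hμ p β₁ τ u
  have e' : ∀ τ u, u ≤ d → pos μ (fun τ => pos μ p β₁ τ d) β'.reverse τ u = pos μ p β' τ (d - u) := by
    intro τ u _
    have : (fun τ => pos μ p β₁ τ d) = fun τ => pos μ p β' τ β'.length := by
      funext τ'; rw [hlen']; exact hcell β₁ hβ₁ β' hβ' τ'
    rw [this, pos_reverse μ hμ p β' τ u, hlen']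
  have := toucher_time_gt hμ hF hI' (Finset.mem_image_of_mem _ hβ₁) (Finset.mem_image_of_mem _ hβ')
    (σ₁ := σ₁) (σ' := σ') (s := d - s) (t := d - t) (by omega) (by omega)
    (by rw [e₁ _ _ (by omega), e' _ _ (by omega), Nat.sub_sub_self hs, Nat.sub_sub_self ht]; exact h1)
    (by rw [e₁ _ _ (by omega), e' _ _ (by omega), Nat.sub_sub_self hs, Nat.sub_sub_self ht]; exact h2)
  omega

end Inherit

end CleanPair

open CleanPair in
/-- **`stub_cornerExclusion`** (registered sub-goal of stmt-MatrixMultiplication-10883): in a level of the depth recursion, a defect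
of `β₁` against `β'` at the common point `pos β' σ' t` has its time strictly inside `(r, d - r)` (ATOM_PROOF §4, corner
exclusion at both ends). -/
theorem stub_cornerExclusion : ∀ (n r d s t : ℕ) (μ : Fin 3 → Equiv.Perm (Fin n)) (F : Finset (Fin n)) (p : Bool → Fin n) (S : Finset (List (Fin 3))) (β₁ β' : List (Fin 3)) (σ₁ σ' : Bool), (∀ c, μ c * μ c = 1) → Summit.MatrixMultiplication.MatrixMultiplication.Theorems.HyperoctahedralThreshold.CleanPair.NoShortCycleOutside μ F r → Summit.MatrixMultiplication.MatrixMultiplication.Theorems.HyperoctahedralThreshold.CleanPair.Inv μ F r p d S → β₁ ∈ S → β' ∈ S → s ≤ d → t ≤ d → Summit.MatrixMultiplication.MatrixMultiplication.Theorems.HyperoctahedralThreshold.CleanPair.pos μ p β₁ σ₁ s = Summit.MatrixMultiplication.MatrixMultiplication.Theorems.HyperoctahedralThreshold.CleanPair.pos μ p β' σ' t → Summit.MatrixMultiplication.MatrixMultiplication.Theorems.HyperoctahedralThreshold.CleanPair.pos μ p β₁ (!σ₁) s ≠ Summit.MatrixMultiplication.MatrixMultiplication.Theorems.HyperoctahedralThreshold.CleanPair.pos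 μ p β' (!σ') t → r < t ∧ t + r < d :=
  fun _ _ _ _ _ _ _ _ _ _ _ _ _ hμ hF hI h₁ h' hs ht e1 e2 =>
    ⟨toucher_time_gt hμ hF hI h₁ h' hs ht e1 e2, toucher_time_lt hμ hF hI h₁ h' hs ht e1 e2⟩

end Summit.MatrixMultiplication.MatrixMultiplication.Theorems.HyperoctahedralThreshold
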